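import Literature.NumberTheory.Sieve.LinearEquationsInPrimesGowersCauchySchwarz
import Literature.NumberTheory.Sieve.LinearEquationsInPrimesTransference
import Mathlib.Data.ZMod.Basic
import Mathlib.Algebra.BigOperators.Fin
import Mathlib.Logic.Equiv.Fin.Basic
import HarnessLib

/-!
# Gowers uniformity norms on `ℤ_{N'}` (Green–Tao 2010, App. B, cyclic-group part)

Trunk T-SIEVE (`Literature/NumberTheory/Sieve`). Second file of the App. B/C layer of the
decomposition of `Literature.NumberTheory.Sieve.GreenTaoZiegler2012_finiteComplexity` (see
`LinearEquationsInPrimesGowersCauchySchwarz.lean` for the box norms). B. Green, T. Tao, *Linear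
equations in primes*, Ann. of Math. 171 (2010), App. B defines the Gowers uniformity norm of
`f : Z → ℂ` on a finite additive group by `‖f‖_{U^{s+1}(Z)} := ‖f(x₁ + ⋯ + x_{s+1})‖_{□^{s+1}(Z^{s+1})}`,
equivalently `‖f‖_{U^{s+1}(Z)}^{2^{s+1}} = 𝔼_{x ∈ Z, h ∈ Z^{s+1}} ∏_ω 𝒞^{|ω|} f(x + ω·h)`, and compares
the local norms `U^{s+1}[N]` with `U^{s+1}(ℤ_{N'})` (Lemma B.5). Everything here is proved, for
real-valued functions on `Z = ℤ_M` and in `2^k`-th power form: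

* `Literature.NumberTheory.Sieve.gowersProd`, `Literature.NumberTheory.Sieve.gowersPower` — `∏_ω g(x + ω·h)` and `‖g‖_{U^k(ℤ_M)}^{2^k}`;
  `Literature.NumberTheory.Sieve.boxPower_linear_eq_gowersPower` — the box power of `x ↦ g(c + ∑ aⱼ xⱼ)` with unit
  coefficients is `‖g‖_{U^k}^{2^k}` (the dilation/translation step of App. C),
  `Literature.NumberTheory.Sieve.gowersPower_eq_boxPower` (the printed definition), `Literature.NumberTheory.Sieve.gowersPower_nonneg`;
* `Literature.NumberTheory.Sieve.gowersPower_sq_le_succ`, `Literature.NumberTheory.Sieve.gowersPower_pow_le_add` — monotonicity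
  `‖g‖_{U^k} ≤ ‖g‖_{U^{k+1}}` (one Cauchy–Schwarz);
* `Literature.NumberTheory.Sieve.gowersPower_two_eq` — `‖g‖_{U²}^4 = 𝔼_t Γ(t)²` with the autocorrelation `Γ`;
  `Literature.NumberTheory.Sieve.expect_mul_apSmooth_pow_four_le` — **a Fourier-free substitute for the Fourier
  expansion of Lipschitz cutoffs in App. C**: for a smoothed progression cutoff
  `φ = c ∗ μ_Q ∗ μ_{-Q}` (`Literature.NumberTheory.Sieve.apSmooth`; `Q = {0, a, …, (q-1)a}`, `a` a unit, `|c| ≤ 1`),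
  `(𝔼 g φ)⁴ ≤ (M/q) ‖g‖_{U²}^4` (two Cauchy–Schwarz steps and the additive energy of `Q`);
* `Literature.NumberTheory.Sieve.extendByZero`, `Literature.NumberTheory.Sieve.gowersPower_extendByZero_le` — the extension by zero `f 1_{[N]}` to
  `ℤ_{N'}` and the comparison `‖f 1_{[N]}‖_{U^k(ℤ_{N'})}^{2^k} ≤ ‖f‖_{U^k[N]}^{2^k}` for `2N ≤ N'`
  (the upper half of Lemma B.5 for `I = [N]`: the cubes of `ℤ_{N'}` inside the image of `[N]`
  are exactly the reductions of the cubes of `ℤ` inside `[N]`, `Literature.NumberTheory.Sieve.exists_lift_of_vertices`,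
  `Literature.NumberTheory.Sieve.reduceParams_injOn`), with `‖·‖_{U^k[N]}` the local norm `Literature.NumberTheory.Sieve.uniformityNorm` of
  `LinearEquationsInPrimesTransference.lean`.

## References

* B. Green, T. Tao, *Linear equations in primes*, Ann. of Math. (2) 171 (2010), 1753–1850
  (arXiv:math/0606088), App. B: the definition of `U^{s+1}(Z)` via box norms and its cube
  form, the local norms `U^{s+1}(A)` (B.11), Lemma B.5 (comparability of `U^{s+1}(I)` and
  `U^{s+1}(ℤ_{N'})`); App. C ("Moving to a cyclic group": extension by zero; the dilation of the
  first `s+1` variables).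
-/

noncomputable section

open Finset
open scoped BigOperators

namespace Literature.NumberTheory.Sieve

/-! ### Gowers uniformity norms on `ℤ_M` (Green–Tao 2010, App. B) -/

section cyclic

variable {M : ℕ} [NeZero M]

/-- Translation invariance of averages over `ℤ_M`. [folklore] -/
theorem expect_add_right (F : ZMod M → ℝ) (c : ZMod M) :
    (𝔼 x, F (x + c)) = (𝔼 y, F y) :=
  expect_comp_equiv (Equiv.addRight c) F

/-- Dilation invariance of averages over `ℤ_M` by a unit. [folklore] -/
theorem expect_unit_mul (F : ZMod M → ℝ) {a : ZMod M} (ha : IsUnit a) :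
    (𝔼 x, F (a * x)) = (𝔼 y, F y) :=
  expect_comp_equiv (ha.unit.mulLeft) F

/-- Affine invariance of averages over `ℤ_M`: `𝔼_x F(a x + c) = 𝔼 F` for a unit `a`. [folklore] -/
theorem expect_affine (F : ZMod M → ℝ) {a : ZMod M} (ha : IsUnit a) (c : ZMod M) :
    (𝔼 x, F (a * x + c)) = (𝔼 y, F y) := by
  rw [expect_unit_mul (fun y => F (y + c)) ha, expect_add_right]

/-- Coordinatewise dilation invariance of averages over `ℤ_M^κ` by units. [folklore] -/
theorem expect_pi_unit_mul {κ : Type*} [Fintype κ] [DecidableEq κ] (F : (κ → ZMod M) → ℝ) {a : κ → ZMod M}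
    (ha : ∀ j, IsUnit (a j)) : (𝔼 h : κ → ZMod M, F (fun j => a j * h j)) = (𝔼 y, F y) :=
  expect_comp_equiv (Equiv.piCongrRight fun j => (ha j).unit.mulLeft) F

/-- The Gowers cube product `∏_{ω ∈ {0,1}^k} g(x + ω · h)` on `ℤ_M` (real-valued `g`).
[cite: GreenTao2010, App. B (definition of `U^{s+1}(Z)`)] -/
def gowersProd (k : ℕ) (g : ZMod M → ℝ) (x : ZMod M) (h : Fin k → ZMod M) : ℝ :=
  ∏ ω : Finset (Fin k), g (x + ∑ j ∈ ω, h j)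

/-- The `2^k`-th power of the Gowers uniformity norm on `ℤ_M`,
`‖g‖_{U^k(ℤ_M)}^{2^k} = 𝔼_{x ∈ ℤ_M, h ∈ ℤ_M^k} ∏_{ω ∈ {0,1}^k} g(x + ω · h)`.
[cite: GreenTao2010, App. B (definition of `U^{s+1}(Z)`)] -/
def gowersPower (k : ℕ) (g : ZMod M → ℝ) : ℝ :=
  (𝔼 p : ZMod M × (Fin k → ZMod M), gowersProd k g p.1 p.2)

/-- Translating the base point does not change the Gowers average. [folklore] -/
theorem expect_gowersProd_add (k : ℕ) (g : ZMod M → ℝ) (c : ZMod M) (h : Fin k → ZMod M) :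
    (𝔼 x, gowersProd k g (x + c) h) = (𝔼 x, gowersProd k g x h) :=
  expect_add_right (fun x => gowersProd k g x h) c

omit [NeZero M] in
/-- Vertex sums of a dilated linear form: `c + ∑_j a_j x^{(ω)}_j = z + ∑_{j ∈ ω} a_j h_j` with
`z = c + ∑_j a_j x⁽⁰⁾_j`, `h = x⁽¹⁾ - x⁽⁰⁾`. [folklore] -/
theorem linear_mixPt_eq {k : ℕ} (c : ZMod M) (a x₀ x₁ : Fin k → ZMod M) (ω : Finset (Fin k)) :
    c + ∑ j, a j * mixPt x₀ x₁ ω j = (c + ∑ j, a j * x₀ j) + ∑ j ∈ ω, a j * (x₁ j - x₀ j) := by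
  have hsplit : ∀ y : Fin k → ZMod M, ∑ j, a j * y j =
      ∑ j ∈ ω, a j * y j + ∑ j ∈ Finset.univ.filter (fun j => j ∉ ω), a j * y j := by
    intro y
    rw [← Finset.sum_filter_add_sum_filter_not Finset.univ (fun j => j ∈ ω)]
    congr 1
    exact Finset.sum_congr (by ext j; simp) fun _ _ => rfl
  have h1 : ∑ j ∈ ω, a j * mixPt x₀ x₁ ω j = ∑ j ∈ ω, a j * x₁ j :=
    Finset.sum_congr rfl fun j hj => by rw [mixPt_of_mem hj]
  have h2 : ∑ j ∈ Finset.univ.filter (fun j => j ∉ ω), a j * mixPt x₀ x₁ ω j =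
      ∑ j ∈ Finset.univ.filter (fun j => j ∉ ω), a j * x₀ j :=
    Finset.sum_congr rfl fun j hj => by rw [mixPt_of_not_mem (Finset.mem_filter.mp hj).2]
  have h3 : ∑ j ∈ ω, a j * (x₁ j - x₀ j) = ∑ j ∈ ω, a j * x₁ j - ∑ j ∈ ω, a j * x₀ j := by
    rw [← Finset.sum_sub_distrib]
    exact Finset.sum_congr rfl fun j _ => by ring
  rw [hsplit (mixPt x₀ x₁ ω), hsplit x₀, h1, h2, h3]
  ring

/-- Change of variables `(x⁽⁰⁾, x⁽¹⁾) ↦ (x⁽⁰⁾, x⁽¹⁾ - x⁽⁰⁾)` in an average over pairs. [folklore] -/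
theorem expect_pair_sub {V : Type*} [AddCommGroup V] [Fintype V] (G : V → V → ℝ) :
    (𝔼 p : V × V, G p.1 (p.2 - p.1)) = (𝔼 p : V × V, G p.1 p.2) := by
  rw [expect_prod_eq, expect_prod_eq]
  congr 1; funext x₀
  exact expect_comp_equiv (Equiv.subRight x₀) (G x₀)

/-- A linear form with a unit coefficient is uniformly distributed:
`𝔼_{x ∈ ℤ_M^k} Φ(c + ∑_j a_j x_j) = 𝔼 Φ` if `a_{j₀}` is a unit. [folklore] -/
theorem expect_linear_uniform {k : ℕ} (Φ : ZMod M → ℝ) (c : ZMod M) {a : Fin k → ZMod M}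
    {j₀ : Fin k} (ha : IsUnit (a j₀)) :
    (𝔼 x₀ : Fin k → ZMod M, Φ (c + ∑ j, a j * x₀ j)) = (𝔼 y, Φ y) := by
  rw [← expect_expect_update j₀ (fun x₀ : Fin k → ZMod M => Φ (c + ∑ j, a j * x₀ j))]
  have : ∀ x₀ : Fin k → ZMod M,
      (𝔼 u : ZMod M, Φ (c + ∑ j, a j * Function.update x₀ j₀ u j)) = (𝔼 y, Φ y) := by
    intro x₀
    have hsplit : ∀ u : ZMod M, c + ∑ j, a j * Function.update x₀ j₀ u j =
        a j₀ * u + (c + ∑ j ∈ Finset.univ.erase j₀, a j * x₀ j) := by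
      intro u
      rw [← Finset.add_sum_erase _ _ (Finset.mem_univ j₀), Function.update_self]
      have : ∑ j ∈ Finset.univ.erase j₀, a j * Function.update x₀ j₀ u j =
          ∑ j ∈ Finset.univ.erase j₀, a j * x₀ j :=
        Finset.sum_congr rfl fun j hj => by rw [Function.update_of_ne (Finset.ne_of_mem_erase hj)]
      rw [this]; ring
    simp_rw [hsplit]
    exact expect_affine Φ ha _
  simp_rw [this]
  exact Fintype.expect_const _

omit [NeZero M] in
/-- The box product of a dilated linear form through `(x⁽⁰⁾, h = x⁽¹⁾ - x⁽⁰⁾)`. [folklore] -/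
theorem boxProd_linear_eq {k : ℕ} (g : ZMod M → ℝ) (c : ZMod M) (a : Fin k → ZMod M) :
    boxProd Finset.univ (fun _ (x : Fin k → ZMod M) => g (c + ∑ j, a j * x j)) =
      fun p => gowersProd k g (c + ∑ j, a j * p.1 j) (fun j => a j * (p.2 - p.1) j) := by
  funext p
  unfold boxProd gowersProd
  rw [Finset.powerset_univ]
  refine Finset.prod_congr rfl fun ω _ => ?_
  dsimp only
  rw [linear_mixPt_eq]
  rfl

/-- **Box powers of linear forms are Gowers powers**: for units `a_j` and any `c`,
`𝔼_{x⁽⁰⁾,x⁽¹⁾ ∈ ℤ_M^k} ∏_{ω} g(c + ∑_j a_j x_j^{(ω_j)}) = ‖g‖_{U^k(ℤ_M)}^{2^k}` (substitute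
`z = c + ∑ a_j x⁽⁰⁾_j`, `h_j = a_j (x⁽¹⁾_j - x⁽⁰⁾_j)`).
[cite: GreenTao2010, App. B (definition of `U^{s+1}(Z)` as a box norm) and App. C (dilation)] -/
theorem boxPower_linear_eq_gowersPower {k : ℕ} (hk : 1 ≤ k) (g : ZMod M → ℝ) (c : ZMod M)
    {a : Fin k → ZMod M} (ha : ∀ j, IsUnit (a j)) :
    boxPower (Finset.univ : Finset (Fin k)) (fun x : Fin k → ZMod M => g (c + ∑ j, a j * x j)) =
      gowersPower k g := by
  unfold boxPower
  rw [boxProd_linear_eq g c a]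
  have h1 := expect_pair_sub (fun (x₀ h : Fin k → ZMod M) =>
    gowersProd k g (c + ∑ j, a j * x₀ j) (fun j => a j * h j))
  rw [h1, expect_prod_eq]
  -- dilate `h`
  have h2 : ∀ x₀ : Fin k → ZMod M,
      (𝔼 h : Fin k → ZMod M, gowersProd k g (c + ∑ j, a j * x₀ j) (fun j => a j * h j)) =
        (𝔼 h : Fin k → ZMod M, gowersProd k g (c + ∑ j, a j * x₀ j) h) := fun x₀ =>
    expect_pi_unit_mul (fun h => gowersProd k g (c + ∑ j, a j * x₀ j) h) ha
  have h3 : (𝔼 x₀ : Fin k → ZMod M, (𝔼 h : Fin k → ZMod M, gowersProd k g (c + ∑ j, a j * x₀ j) (fun j => a j * h j))) =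
      (𝔼 x₀ : Fin k → ZMod M, (𝔼 h : Fin k → ZMod M, gowersProd k g (c + ∑ j, a j * x₀ j) h)) := by
    congr 1; funext x₀; exact h2 x₀
  refine h3.trans ?_
  -- the base point is uniformly distributed
  rw [expect_linear_uniform (fun z => (𝔼 h : Fin k → ZMod M, gowersProd k g z h)) c
    (ha ⟨0, hk⟩)]
  unfold gowersPower
  exact expect_expect_eq_expect_prod _

/-- `‖g‖_{U^k(ℤ_M)}^{2^k}` as the box power of `(x₁, …, x_k) ↦ g(x₁ + ⋯ + x_k)`.
[cite: GreenTao2010, App. B (definition of `U^{s+1}(Z)`)] -/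
theorem gowersPower_eq_boxPower {k : ℕ} (hk : 1 ≤ k) (g : ZMod M → ℝ) :
    gowersPower k g =
      boxPower (Finset.univ : Finset (Fin k)) (fun x : Fin k → ZMod M => g (∑ j, x j)) := by
  rw [← boxPower_linear_eq_gowersPower hk g 0 (a := fun _ => 1) fun _ => isUnit_one]
  simp

/-- `‖g‖_{U^k(ℤ_M)}^{2^k} ≥ 0` for `k ≥ 1`. [cite: GreenTao2010, App. B] -/
theorem gowersPower_nonneg {k : ℕ} (hk : 1 ≤ k) (g : ZMod M → ℝ) : 0 ≤ gowersPower k g := by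
  rw [gowersPower_eq_boxPower hk]
  exact boxPower_nonneg ⟨⟨0, hk⟩, Finset.mem_univ _⟩ _

/-- Splitting the cube `{0,1}^{k+1}` along the last coordinate:
`∏_{ω ⊆ [k+1]} F(ω) = ∏_{ω' ⊆ [k]} F(ω') F(ω' ∪ {k+1})` (with `[k] ↪ [k+1]`). [folklore] -/
theorem prod_powerset_fin_succ (k : ℕ) (F : Finset (Fin (k + 1)) → ℝ) :
    ∏ ω : Finset (Fin (k + 1)), F ω =
      ∏ ω' : Finset (Fin k), F (ω'.map Fin.castSuccEmb) *
        F (insert (Fin.last k) (ω'.map Fin.castSuccEmb)) := by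
  have hlast : Fin.last k ∉ (Finset.univ : Finset (Fin k)).map Fin.castSuccEmb := by simp
  rw [← Finset.powerset_univ, Fin.univ_castSuccEmb, Finset.cons_eq_insert,
    Finset.prod_powerset_insert hlast, ← Finset.prod_mul_distrib, ← Finset.powerset_univ]
  -- reindex the powerset of the image
  refine Finset.prod_bij' (fun ω _ => Finset.univ.filter fun j => Fin.castSucc j ∈ ω)
    (fun ω' _ => ω'.map Fin.castSuccEmb) ?_ ?_ ?_ ?_ ?_
  · intro ω _; exact Finset.mem_powerset.mpr (Finset.filter_subset _ _)
  · intro ω' _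
    exact Finset.mem_powerset.mpr (Finset.map_subset_map.mpr (Finset.subset_univ _))
  · intro ω hω
    have hω' := Finset.mem_powerset.mp hω
    ext a
    simp only [Finset.mem_map, Finset.mem_filter, Finset.mem_univ, true_and,
      Fin.castSuccEmb_apply]
    constructor
    · rintro ⟨j, hj, rfl⟩; exact hj
    · intro ha
      obtain ⟨j, _, rfl⟩ := Finset.mem_map.mp (hω' ha)
      exact ⟨j, ha, rfl⟩
  · intro ω' _
    ext j
    simp
  · intro ω hω
    have hω' := Finset.mem_powerset.mp hω
    have heq : (Finset.univ.filter fun j => Fin.castSucc j ∈ ω).map Fin.castSuccEmb = ω := by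
      ext a
      simp only [Finset.mem_map, Finset.mem_filter, Finset.mem_univ, true_and,
        Fin.castSuccEmb_apply]
      constructor
      · rintro ⟨j, hj, rfl⟩; exact hj
      · intro ha
        obtain ⟨j, _, rfl⟩ := Finset.mem_map.mp (hω' ha)
        exact ⟨j, ha, rfl⟩
    rw [heq]

omit [NeZero M] in
/-- Splitting the Gowers cube product along the last direction:
`∏_{ω ∈ {0,1}^{k+1}} g(x + ω·(h', t)) = (∏_{ω' ∈ {0,1}^k} g(x + ω'·h')) ∏_{ω'} g(x + t + ω'·h')`.
[cite: GreenTao2010, App. B] -/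
theorem gowersProd_succ (k : ℕ) (g : ZMod M → ℝ) (x t : ZMod M) (h' : Fin k → ZMod M) :
    gowersProd (k + 1) g x (Fin.snoc h' t) = gowersProd k g x h' * gowersProd k g (x + t) h' := by
  unfold gowersProd
  rw [prod_powerset_fin_succ, Finset.prod_mul_distrib]
  have hlast : ∀ ω' : Finset (Fin k), Fin.last k ∉ ω'.map Fin.castSuccEmb := fun ω' => by simp
  congr 1
  · refine Fintype.prod_congr _ _ fun ω' => ?_
    rw [Finset.sum_map]
    simp
  · refine Fintype.prod_congr _ _ fun ω' => ?_
    rw [Finset.sum_insert (hlast ω'), Finset.sum_map]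
    simp only [Fin.snoc_last, Fin.castSuccEmb_apply, Fin.snoc_castSucc]
    ring_nf

/-- **Monotonicity of the Gowers norms** `‖g‖_{U^k} ≤ ‖g‖_{U^{k+1}}`, in power form:
`(‖g‖_{U^k}^{2^k})² ≤ ‖g‖_{U^{k+1}}^{2^{k+1}}` (one application of Cauchy–Schwarz).
[cite: GreenTao2010, App. B] -/
theorem gowersPower_sq_le_succ (k : ℕ) (g : ZMod M → ℝ) :
    gowersPower k g ^ 2 ≤ gowersPower (k + 1) g := by
  -- split `h = (h', t)`
  set P : ZMod M → (Fin k → ZMod M) → ℝ := fun x h' => gowersProd k g x h' with hP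
  have hx : ∀ x : ZMod M, (𝔼 h : Fin (k + 1) → ZMod M, gowersProd (k + 1) g x h) =
      (𝔼 q : ZMod M × (Fin k → ZMod M), P x q.2 * P (x + q.1) q.2) := by
    intro x
    rw [← expect_comp_equiv (Fin.snocEquiv fun _ => ZMod M)]
    show (𝔼 q : ZMod M × (Fin k → ZMod M), gowersProd (k + 1) g x (Fin.snoc q.2 q.1)) = _
    simp_rw [gowersProd_succ]
    rfl
  have hsplit : gowersPower (k + 1) g =
      (𝔼 h' : Fin k → ZMod M, (𝔼 x : ZMod M, P x h') ^ 2) := by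
    unfold gowersPower
    rw [expect_prod_eq]
    simp_rw [hx]
    -- reorder the averages to `h', x, t`
    have e1 : ∀ x : ZMod M, (𝔼 q : ZMod M × (Fin k → ZMod M), P x q.2 * P (x + q.1) q.2) =
        (𝔼 h' : Fin k → ZMod M, P x h' * (𝔼 x' : ZMod M, P x' h')) := by
      intro x
      rw [expect_prod_eq']
      congr 1; funext h'
      show (𝔼 t : ZMod M, P x h' * P (x + t) h') = _
      rw [← Finset.mul_expect]
      congr 1
      simp_rw [add_comm x]
      exact expect_add_right (fun x' => P x' h') x
    simp_rw [e1]
    rw [Finset.expect_comm]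
    congr 1; funext h'
    rw [← Finset.expect_mul, sq]
  rw [hsplit]
  have hk : gowersPower k g = (𝔼 h' : Fin k → ZMod M, (𝔼 x : ZMod M, P x h')) := by
    unfold gowersPower
    exact expect_prod_eq' _
  rw [hk]
  -- Jensen / Cauchy–Schwarz: `(𝔼 F)² ≤ 𝔼 F²`
  have := Finset.expect_mul_sq_le_sq_mul_sq Finset.univ (fun h' : Fin k → ZMod M => (𝔼 x : ZMod M, P x h'))
    (fun _ => (1 : ℝ))
  simp only [mul_one, one_pow, Fintype.expect_const] at this
  simpa using this

/-- Monotonicity iterated: `(‖g‖_{U^k}^{2^k})^{2^m} ≤ ‖g‖_{U^{k+m}}^{2^{k+m}}` for `k ≥ 1`.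
[cite: GreenTao2010, App. B] -/
theorem gowersPower_pow_le_add {k : ℕ} (hk : 1 ≤ k) (m : ℕ) (g : ZMod M → ℝ) :
    gowersPower k g ^ (2 ^ m) ≤ gowersPower (k + m) g := by
  induction m with
  | zero => simp
  | succ m ih =>
    rw [pow_succ, pow_mul]
    calc (gowersPower k g ^ 2 ^ m) ^ 2 ≤ gowersPower (k + m) g ^ 2 :=
          pow_le_pow_left₀ (pow_nonneg (gowersPower_nonneg hk g) _) ih 2
      _ ≤ gowersPower (k + m + 1) g := gowersPower_sq_le_succ _ _

end cyclic


section smoothing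

variable {M : ℕ} [NeZero M]

/-- The autocorrelation `Γ(t) = 𝔼_y g(y) g(y + t)`. [folklore] -/
def autocorr (g : ZMod M → ℝ) (t : ZMod M) : ℝ :=
  (𝔼 y, g y * g (y + t))

omit [NeZero M] in
/-- The cube product over `{0,1}²`. [folklore] -/
theorem gowersProd_two (g : ZMod M → ℝ) (x : ZMod M) (h : Fin 2 → ZMod M) :
    gowersProd 2 g x h = (g x * g (x + h 0)) * (g (x + h 1) * g (x + h 0 + h 1)) := by
  unfold gowersProd
  rw [show (Finset.univ : Finset (Finset (Fin 2))) = {∅, {0}, {1}, {0, 1}} from by decide,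
    Finset.prod_insert (by decide), Finset.prod_insert (by decide),
    Finset.prod_insert (by decide), Finset.prod_singleton, Finset.sum_empty,
    Finset.sum_singleton, Finset.sum_singleton, Finset.sum_insert (by decide),
    Finset.sum_singleton, add_zero, ← add_assoc]
  ring

/-- The `U²` Gowers power as the mean square of the autocorrelation:
`‖g‖_{U²}^4 = 𝔼_t Γ(t)²`. [folklore] -/
theorem gowersPower_two_eq (g : ZMod M → ℝ) :
    gowersPower 2 g = (𝔼 t, autocorr g t ^ 2) := by
  unfold gowersPower
  rw [← expect_comp_equiv (Equiv.prodCongr (Equiv.refl (ZMod M)) (finTwoArrowEquiv (ZMod M)).symm)]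
  have h1 : (fun q : ZMod M × (ZMod M × ZMod M) => gowersProd 2 g
      ((Equiv.prodCongr (Equiv.refl (ZMod M)) (finTwoArrowEquiv (ZMod M)).symm) q).1
      ((Equiv.prodCongr (Equiv.refl (ZMod M)) (finTwoArrowEquiv (ZMod M)).symm) q).2) =
      fun q => (g q.1 * g (q.1 + q.2.1)) * (g (q.1 + q.2.2) * g (q.1 + q.2.1 + q.2.2)) := by
    funext q
    rw [Equiv.prodCongr_apply, Prod.map_fst, Prod.map_snd, gowersProd_two]
    simp [finTwoArrowEquiv]
  rw [h1, expect_prod_eq]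
  -- `𝔼_x 𝔼_{(u,v)} … = 𝔼_u (𝔼_x g(x)g(x+u)) (𝔼_y g(y) g(y+u))`
  have h2 : ∀ x : ZMod M, (𝔼 w : ZMod M × ZMod M, (g x * g (x + w.1)) * (g (x + w.2) * g (x + w.1 + w.2))) =
      (𝔼 u : ZMod M, g x * g (x + u) * autocorr g u) := by
    intro x
    rw [expect_prod_eq]
    congr 1; funext u
    unfold autocorr
    rw [← expect_add_right (fun y => g y * g (y + u)) x, Finset.mul_expect]
    congr 1; funext v
    ring_nf
  simp_rw [h2]
  rw [Finset.expect_comm]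
  congr 1; funext u
  rw [← Finset.expect_mul, sq]
  rfl

/-- The points `j a`, `j < q`, of the progression `Q = {0, a, …, (q-1) a}`. [folklore] -/
def apPoint (a : ZMod M) (q : ℕ) (j : Fin q) : ZMod M :=
  ((j : ℕ) : ZMod M) * a

/-- The smoothed cutoff `(c ∗ μ_Q ∗ μ_{-Q})(x) = 𝔼_{j,j' < q} c(x - j a + j' a)` along the
progression `Q = {0, a, …, (q-1)a}` (for `c = 1_P` an interval and `a = 1` this is a trapezoid).
[folklore] -/
def apSmooth (c : ZMod M → ℝ) (a : ZMod M) (q : ℕ) (x : ZMod M) : ℝ :=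
  (𝔼 jj : Fin q × Fin q, c (x - apPoint a q jj.1 + apPoint a q jj.2))

omit [NeZero M] in
/-- `|c| ≤ 1` implies `|c ∗ μ_Q ∗ μ_{-Q}| ≤ 1`. [folklore] -/
theorem abs_apSmooth_le {c : ZMod M → ℝ} (hc : ∀ x, |c x| ≤ 1) (a : ZMod M) {q : ℕ} (hq : 1 ≤ q)
    (x : ZMod M) : |apSmooth c a q x| ≤ 1 := by
  haveI : NeZero q := ⟨by omega⟩
  unfold apSmooth
  refine ((Finset.abs_expect_le _ _).trans (Finset.expect_le_expect fun jj _ => hc _)).trans ?_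
  rw [Fintype.expect_const]

omit [NeZero M] in
/-- `0 ≤ c` implies `0 ≤ c ∗ μ_Q ∗ μ_{-Q}`. [folklore] -/
theorem apSmooth_nonneg {c : ZMod M → ℝ} (hc : ∀ x, 0 ≤ c x) (a : ZMod M) (q : ℕ)
    (x : ZMod M) : 0 ≤ apSmooth c a q x :=
  Finset.expect_nonneg fun _ _ => hc _

omit [NeZero M] in
/-- At most one `j < q ≤ M` solves `j a = r` in `ℤ_M` when `a` is a unit. [folklore] -/
theorem expect_indicator_apPoint_le {a : ZMod M} (ha : IsUnit a) {q : ℕ} (hqM : q ≤ M)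
    (r : ZMod M) :
    (𝔼 j : Fin q, if apPoint a q j = r then (1 : ℝ) else 0) ≤ 1 / q := by
  rw [Fintype.expect_eq_sum_div_card]
  rw [Finset.sum_boole, Fintype.card_fin]
  refine div_le_div_of_nonneg_right ?_ (Nat.cast_nonneg _)
  norm_cast
  rw [Finset.card_le_one]
  intro i hi j hj
  simp only [Finset.mem_filter, Finset.mem_univ, true_and, apPoint] at hi hj
  have hij : ((i : ℕ) : ZMod M) = ((j : ℕ) : ZMod M) :=
    ha.mul_left_injective (hi.trans hj.symm)
  have := congr_arg ZMod.val hij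
  rw [ZMod.val_natCast_of_lt (lt_of_lt_of_le i.2 hqM),
    ZMod.val_natCast_of_lt (lt_of_lt_of_le j.2 hqM)] at this
  exact Fin.ext this

/-- **Correlations with smoothed progressions are controlled by `U²`** (a Fourier-free
substitute for the Fourier expansion of Lipschitz cutoffs in App. C of Green–Tao 2010): for a
unit step `a`, `1 ≤ q ≤ M` and `|c| ≤ 1`,
`(𝔼_x g(x) (c ∗ μ_Q ∗ μ_{-Q})(x))⁴ ≤ (M/q) ‖g‖_{U²(ℤ_M)}^4` (Cauchy–Schwarz twice and the
bound `q³` for the additive energy of `Q = {0, a, …, (q-1)a}`). [folklore] -/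
theorem expect_mul_apSmooth_pow_four_le (g : ZMod M → ℝ) {c : ZMod M → ℝ} (hc : ∀ x, |c x| ≤ 1)
    {a : ZMod M} (ha : IsUnit a) {q : ℕ} (hq : 1 ≤ q) (hqM : q ≤ M) :
    (𝔼 x, g x * apSmooth c a q x) ^ 4 ≤ (M : ℝ) / q * gowersPower 2 g := by
  haveI : NeZero q := ⟨by omega⟩
  -- Step 1: `T = 𝔼_y c(y) R(y)` with `R(y) = 𝔼_{j,j'} g(y + j a - j' a)`
  have hT : (𝔼 x, g x * apSmooth c a q x) = (𝔼 y, c y *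
      (𝔼 jj : Fin q × Fin q, g (y + apPoint a q jj.1 - apPoint a q jj.2))) := by
    unfold apSmooth
    simp_rw [Finset.mul_expect]
    rw [Finset.expect_comm Finset.univ Finset.univ (fun (x : ZMod M) (jj : Fin q × Fin q) =>
        g x * c (x - apPoint a q jj.1 + apPoint a q jj.2)),
      Finset.expect_comm Finset.univ Finset.univ (fun (y : ZMod M) (jj : Fin q × Fin q) =>
        c y * g (y + apPoint a q jj.1 - apPoint a q jj.2))]
    congr 1; funext jj
    rw [← expect_add_right (fun x => g x * c (x - apPoint a q jj.1 + apPoint a q jj.2))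
      (apPoint a q jj.1 - apPoint a q jj.2)]
    congr 1; funext y
    rw [mul_comm]
    congr 2 <;> ring
  -- Step 2: `T² ≤ 𝔼 R²`
  have h2 : (𝔼 x, g x * apSmooth c a q x) ^ 2 ≤ (𝔼 y, (𝔼 jj : Fin q × Fin q, g (y + apPoint a q jj.1 - apPoint a q jj.2)) ^ 2) := by
    rw [hT]
    refine (Finset.expect_mul_sq_le_sq_mul_sq _ c _).trans ?_
    have hc2 : (𝔼 y, c y ^ 2) ≤ 1 := by
      refine (Finset.expect_le_expect (g := fun _ => (1 : ℝ)) fun y _ => ?_).trans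
        (le_of_eq (Fintype.expect_const _))
      have := hc y
      rw [abs_le] at this
      nlinarith
    calc (𝔼 y, c y ^ 2) * (𝔼 y, (𝔼 jj : Fin q × Fin q, g (y + apPoint a q jj.1 - apPoint a q jj.2)) ^ 2)
        ≤ 1 * (𝔼 y, (𝔼 jj : Fin q × Fin q, g (y + apPoint a q jj.1 - apPoint a q jj.2)) ^ 2) :=
          mul_le_mul_of_nonneg_right hc2 (Finset.expect_nonneg fun _ _ => sq_nonneg _)
      _ = _ := one_mul _
  -- Step 3: `𝔼 R² ≤ 𝔼 S²` with `S(z) = 𝔼_j g(z + j a)` (`R(y) = 𝔼_{j'} S(y - j' a)`, Jensen)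
  have hRS : ∀ y : ZMod M, (𝔼 jj : Fin q × Fin q, g (y + apPoint a q jj.1 - apPoint a q jj.2)) =
      (𝔼 j₂ : Fin q, (𝔼 j₁ : Fin q, g (y - apPoint a q j₂ + apPoint a q j₁))) := by
    intro y
    rw [expect_prod_eq']
    congr 1; funext j₂; congr 1; funext j₁
    ring_nf
  have h3 : (𝔼 y, (𝔼 jj : Fin q × Fin q, g (y + apPoint a q jj.1 - apPoint a q jj.2)) ^ 2) ≤
      (𝔼 z, (𝔼 j : Fin q, g (z + apPoint a q j)) ^ 2) := by
    have hJ : ∀ y, (𝔼 jj : Fin q × Fin q, g (y + apPoint a q jj.1 - apPoint a q jj.2)) ^ 2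
        ≤ (𝔼 j₂ : Fin q, (𝔼 j₁ : Fin q, g (y - apPoint a q j₂ + apPoint a q j₁)) ^ 2) := by
      intro y
      rw [hRS]
      have := Finset.expect_mul_sq_le_sq_mul_sq Finset.univ (fun j₂ : Fin q => (𝔼 j₁ : Fin q, g (y - apPoint a q j₂ + apPoint a q j₁))) (fun _ => (1 : ℝ))
      simp only [mul_one, one_pow, Fintype.expect_const] at this
      simpa using this
    refine (Finset.expect_le_expect fun y _ => hJ y).trans (le_of_eq ?_)
    rw [Finset.expect_comm]
    have : ∀ j₂ : Fin q, (𝔼 y : ZMod M, (𝔼 j₁ : Fin q, g (y - apPoint a q j₂ + apPoint a q j₁)) ^ 2) =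
        (𝔼 z, (𝔼 j : Fin q, g (z + apPoint a q j)) ^ 2) := by
      intro j₂
      simp_rw [sub_eq_add_neg]
      exact expect_add_right (fun z => (𝔼 j : Fin q, g (z + apPoint a q j)) ^ 2) _
    simp_rw [this]
    exact Fintype.expect_const _
  -- Step 4: `𝔼 S² = 𝔼_{j,j'} Γ(j' a - j a)`
  have h4 : (𝔼 z, (𝔼 j : Fin q, g (z + apPoint a q j)) ^ 2) =
      (𝔼 J : Fin q × Fin q, autocorr g (apPoint a q J.2 - apPoint a q J.1)) := by
    have : ∀ z : ZMod M, (𝔼 j : Fin q, g (z + apPoint a q j)) ^ 2 =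
        (𝔼 J : Fin q × Fin q, g (z + apPoint a q J.1) * g (z + apPoint a q J.2)) := by
      intro z
      rw [sq, ← expect_prod_mul]
    simp_rw [this]
    rw [Finset.expect_comm]
    congr 1; funext J
    unfold autocorr
    rw [← expect_add_right (fun y => g y * g (y + (apPoint a q J.2 - apPoint a q J.1)))
      (apPoint a q J.1)]
    congr 1; funext z
    ring_nf
  -- Step 5: Cauchy–Schwarz over `t` with the collision bound
  have h5a : (𝔼 J : Fin q × Fin q, autocorr g (apPoint a q J.2 - apPoint a q J.1)) =
      ∑ t, autocorr g t * (𝔼 J : Fin q × Fin q, if apPoint a q J.2 - apPoint a q J.1 = t then (1 : ℝ) else 0) := by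
    have : ∀ J : Fin q × Fin q, autocorr g (apPoint a q J.2 - apPoint a q J.1) =
        ∑ t, autocorr g t * (if apPoint a q J.2 - apPoint a q J.1 = t then (1 : ℝ) else 0) := by
      intro J
      simp_rw [mul_ite, mul_one, mul_zero]
      rw [Finset.sum_ite_eq]
      simp
    simp_rw [this]
    rw [Finset.expect_sum_comm]
    simp_rw [← Finset.mul_expect]
  have h5b : ∑ t, (𝔼 J : Fin q × Fin q, if apPoint a q J.2 - apPoint a q J.1 = t then (1 : ℝ) else 0) ^ 2 ≤ 1 / q := by
    -- `∑_t w(t)² = ℙ(j₂' a - j₂ a = j₁' a - j₁ a) ≤ 1/q`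
    have hsq : ∀ t : ZMod M, (𝔼 J : Fin q × Fin q, if apPoint a q J.2 - apPoint a q J.1 = t then (1 : ℝ) else 0) ^ 2 =
        (𝔼 JJ : (Fin q × Fin q) × (Fin q × Fin q), (if apPoint a q JJ.1.2 - apPoint a q JJ.1.1 = t then (1 : ℝ) else 0) *
          (if apPoint a q JJ.2.2 - apPoint a q JJ.2.1 = t then (1 : ℝ) else 0)) := by
      intro t
      rw [sq, ← expect_prod_mul]
    simp_rw [hsq]
    rw [← Finset.expect_sum_comm]
    have hcoll : ∀ JJ : (Fin q × Fin q) × (Fin q × Fin q),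
        ∑ t, (if apPoint a q JJ.1.2 - apPoint a q JJ.1.1 = t then (1 : ℝ) else 0) *
          (if apPoint a q JJ.2.2 - apPoint a q JJ.2.1 = t then (1 : ℝ) else 0) =
        if apPoint a q JJ.2.2 = apPoint a q JJ.1.2 - apPoint a q JJ.1.1 + apPoint a q JJ.2.1
          then (1 : ℝ) else 0 := by
      intro JJ
      simp_rw [ite_mul, one_mul, zero_mul]
      rw [Finset.sum_ite_eq]
      simp only [Finset.mem_univ, if_true]
      congr 1
      apply propext
      constructor
      · intro h; rw [← h]; ring
      · intro h; rw [h]; ring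
    simp_rw [hcoll]
    -- innermost average over `j₂'`
    rw [expect_prod_eq]
    calc (𝔼 J : Fin q × Fin q, (𝔼 J' : Fin q × Fin q, if apPoint a q J'.2 = apPoint a q J.2 - apPoint a q J.1 + apPoint a q J'.1
            then (1 : ℝ) else 0))
        ≤ (𝔼 _ : Fin q × Fin q, (1 : ℝ) / q) := by
          refine Finset.expect_le_expect fun J _ => ?_
          rw [expect_prod_eq]
          refine (Finset.expect_le_expect (g := fun _ => (1 : ℝ) / q) fun j₂ _ => ?_).trans
            (le_of_eq (Fintype.expect_const _))
          dsimp only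
          exact expect_indicator_apPoint_le ha hqM _
      _ = 1 / q := Fintype.expect_const _
  have h5 : (𝔼 z, (𝔼 j : Fin q, g (z + apPoint a q j)) ^ 2) ^ 2 ≤
      (M : ℝ) / q * gowersPower 2 g := by
    rw [h4, h5a]
    refine (Finset.sum_mul_sq_le_sq_mul_sq _ _ _).trans ?_
    rw [gowersPower_two_eq]
    have hΓ : ∑ t, autocorr g t ^ 2 = (M : ℝ) * (𝔼 t, autocorr g t ^ 2) := by
      rw [Fintype.expect_eq_sum_div_card]
      rw [ZMod.card, mul_div_cancel₀ _ (by exact_mod_cast NeZero.ne M)]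
    rw [hΓ]
    calc (M : ℝ) * (𝔼 t, autocorr g t ^ 2) * ∑ t, (𝔼 J : Fin q × Fin q, if apPoint a q J.2 - apPoint a q J.1 = t then (1 : ℝ) else 0) ^ 2
        ≤ (M : ℝ) * (𝔼 t, autocorr g t ^ 2) * (1 / q) :=
          mul_le_mul_of_nonneg_left h5b (mul_nonneg (Nat.cast_nonneg _)
            (Finset.expect_nonneg fun _ _ => sq_nonneg _))
      _ = (M : ℝ) / q * (𝔼 t, autocorr g t ^ 2) := by ring
  -- assemble: `T⁴ = (T²)² ≤ (𝔼 R²)² ≤ (𝔼 S²)² ≤ …`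
  calc (𝔼 x, g x * apSmooth c a q x) ^ 4
      = ((𝔼 x, g x * apSmooth c a q x) ^ 2) ^ 2 := by ring
    _ ≤ (𝔼 z, (𝔼 j : Fin q, g (z + apPoint a q j)) ^ 2) ^ 2 :=
        pow_le_pow_left₀ (sq_nonneg _) (h2.trans h3) 2
    _ ≤ _ := h5

end smoothing


/-! ### Comparison with the local norms `U^k[N]` (Green–Tao 2010, Lemma B.5) -/

section compare

variable {N' : ℕ} [NeZero N']

/-- The extension by zero `f 1_{[N]}` of `f|_{[N]}` to `ℤ_{N'}` ("embed `[N]` inside `ℤ_{N'}` in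
the usual manner, and extend the functions to all of `ℤ_{N'}` by defining them to be zero
outside of `[N]`"). [cite: GreenTao2010, App. C (Moving to a cyclic group)] -/
def extendByZero (N' N : ℕ) (f : ℤ → ℝ) (y : ZMod N') : ℝ :=
  if 1 ≤ y.val ∧ y.val ≤ N then f (y.val : ℤ) else 0

omit [NeZero N'] in
/-- `|f| ≤ g` on `[N]` gives `|f 1_{[N]}| ≤ g 1_{[N]}` on `ℤ_{N'}`. [folklore] -/
theorem abs_extendByZero_le {N : ℕ} {f g : ℤ → ℝ}
    (h : ∀ x : ℤ, 1 ≤ x → x ≤ N → |f x| ≤ g x) (y : ZMod N') :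
    |extendByZero N' N f y| ≤ extendByZero N' N g y := by
  unfold extendByZero
  split_ifs with hy
  · exact h _ (by exact_mod_cast hy.1) (by exact_mod_cast hy.2)
  · simp

omit [NeZero N'] in
/-- Two integers of `(-N', N')` distance that agree mod `N'` are equal. [folklore] -/
theorem int_eq_of_zmod_eq {a b : ℤ} (hab : (a : ZMod N') = (b : ZMod N')) (hlt : |b - a| < N') :
    a = b := by
  have hdvd : (N' : ℤ) ∣ b - a := (ZMod.intCast_eq_intCast_iff_dvd_sub a b N').mp hab
  have := Int.eq_zero_of_abs_lt_dvd hdvd hlt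
  omega

/-- The value of `f 1_{[N]}` at the image of `v ∈ [N]` (`N < N'`). [folklore] -/
theorem extendByZero_intCast {N : ℕ} (hNN' : N < N') (f : ℤ → ℝ) {v : ℤ} (hv1 : 1 ≤ v)
    (hvN : v ≤ N) : extendByZero N' N f (v : ZMod N') = f v := by
  have hval : (((v : ZMod N').val : ℕ) : ℤ) = v := by
    rw [ZMod.val_intCast]
    exact Int.emod_eq_of_lt (by omega) (by omega)
  unfold extendByZero
  rw [if_pos ⟨by omega, by omega⟩, hval]

omit [NeZero N'] in
/-- A residue in the image of `[N]` is the image of its lift `val ∈ [N]`. [folklore] -/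
theorem extendByZero_ne_zero {N : ℕ} {f : ℤ → ℝ} {y : ZMod N'} (h : extendByZero N' N f y ≠ 0) :
    1 ≤ y.val ∧ y.val ≤ N := by
  unfold extendByZero at h
  by_contra hy
  exact h (if_neg hy)

/-- Reduction of cube parameters modulo `N'`. [folklore] -/
def reduceParams (N' : ℕ) {k : ℕ} (p : ℤ × (Fin k → ℤ)) : ZMod N' × (Fin k → ZMod N') :=
  ((p.1 : ZMod N'), fun j => (p.2 j : ZMod N'))

omit [NeZero N'] in
/-- Vertices reduce to vertices. [folklore] -/
theorem reduceParams_vertex {k : ℕ} (p : ℤ × (Fin k → ℤ)) (ω : Finset (Fin k)) :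
    (reduceParams N' p).1 + ∑ j ∈ ω, (reduceParams N' p).2 j =
      ((cubeVertex p.1 p.2 ω : ℤ) : ZMod N') := by
  simp [reduceParams, cubeVertex]

omit [NeZero N'] in
/-- **Injectivity**: cubes in `[N]` are determined by their reductions mod `N' > N`
("the interval `[N]` is Freiman isomorphic to its counterpart in `ℤ_{N'}`").
[cite: GreenTao2010, App. B, proof of Lemma B.5] -/
theorem reduceParams_injOn {k N : ℕ} (hNN' : N < N') :
    Set.InjOn (reduceParams N' (k := k)) (gowersCubeParams k N : Set (ℤ × (Fin k → ℤ))) := by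
  intro p hp p' hp' hpp'
  have hp0 := Finset.mem_Icc.mp (mem_gowersCubeParams.mp (Finset.mem_coe.mp hp) ∅)
  have hp0' := Finset.mem_Icc.mp (mem_gowersCubeParams.mp (Finset.mem_coe.mp hp') ∅)
  simp only [cubeVertex_empty] at hp0 hp0'
  simp only [reduceParams, Prod.mk.injEq] at hpp'
  have h1 : p.1 = p'.1 := int_eq_of_zmod_eq hpp'.1 (by rw [abs_lt]; constructor <;> omega)
  have h2 : p.2 = p'.2 := by
    funext j
    have hj := Finset.mem_Icc.mp (mem_gowersCubeParams.mp (Finset.mem_coe.mp hp) {j})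
    have hj' := Finset.mem_Icc.mp (mem_gowersCubeParams.mp (Finset.mem_coe.mp hp') {j})
    simp only [cubeVertex_singleton] at hj hj'
    exact int_eq_of_zmod_eq (congr_fun hpp'.2 j) (by rw [abs_lt]; constructor <;> omega)
  exact Prod.ext h1 h2

/-- **Lifting**: if every vertex of a cube of `ℤ_{N'}` lies in the image of `[N]`, `2N ≤ N'`,
then the cube is the reduction of a cube in `[N]` (by induction over the vertices: a vertex
of `ω ∪ {j}` is determined by those of `ω`, `{j}`, `∅` up to an ambiguity `< N'`).
[cite: GreenTao2010, App. B, proof of Lemma B.5] -/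
theorem exists_lift_of_vertices {k N : ℕ} (hN : 2 * N ≤ N') (q : ZMod N' × (Fin k → ZMod N'))
    (hq : ∀ ω : Finset (Fin k), 1 ≤ (q.1 + ∑ j ∈ ω, q.2 j).val ∧ (q.1 + ∑ j ∈ ω, q.2 j).val ≤ N) :
    ∃ p ∈ gowersCubeParams k N, reduceParams N' p = q := by
  -- the lift
  set x : ℤ := (q.1.val : ℤ) with hx
  set h : Fin k → ℤ := fun j => ((q.1 + q.2 j).val : ℤ) - x with hh
  have hxq : (x : ZMod N') = q.1 := by rw [hx, Int.cast_natCast, ZMod.natCast_zmod_val]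
  have hhq : ∀ j, (h j : ZMod N') = q.2 j := by
    intro j
    rw [hh]
    push_cast
    rw [ZMod.natCast_zmod_val, hx, Int.cast_natCast, ZMod.natCast_zmod_val]
    ring
  have hred : reduceParams N' (x, h) = q := by
    ext
    · exact hxq
    · exact hhq _
  -- all vertices are genuinely in `[N]`
  have hvert : ∀ ω : Finset (Fin k), 1 ≤ cubeVertex x h ω ∧ cubeVertex x h ω ≤ N := by
    intro ω
    induction ω using Finset.induction_on with
    | empty =>
      have := hq ∅
      simp only [Finset.sum_empty, add_zero] at this
      simp only [cubeVertex_empty, hx]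
      exact ⟨by exact_mod_cast this.1, by exact_mod_cast this.2⟩
    | insert j ω hj ih =>
      have hωj := hq (insert j ω)
      have h0 := hq ∅
      have h1 := hq {j}
      simp only [Finset.sum_empty, add_zero] at h0
      simp only [Finset.sum_singleton] at h1
      -- `vertex (ω ∪ {j}) = vertex ω + h j` as integers, and mod `N'` it is the given vertex
      have hsplit : cubeVertex x h (insert j ω) = cubeVertex x h ω + h j := by
        simp only [cubeVertex, Finset.sum_insert hj]; ring
      set c : ℤ := ((q.1 + ∑ i ∈ insert j ω, q.2 i).val : ℤ) with hc
      have hcq : (c : ZMod N') = q.1 + ∑ i ∈ insert j ω, q.2 i := by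
        rw [hc, Int.cast_natCast, ZMod.natCast_zmod_val]
      have hvq : ((cubeVertex x h (insert j ω) : ℤ) : ZMod N') =
          q.1 + ∑ i ∈ insert j ω, q.2 i := by
        have := reduceParams_vertex (N' := N') (x, h) (insert j ω)
        rw [hred] at this
        exact this.symm
      have heq : cubeVertex x h (insert j ω) = c := by
        refine int_eq_of_zmod_eq (hvq.trans hcq.symm) ?_
        rw [hsplit, abs_lt]
        have hb1 : 1 - (N : ℤ) ≤ h j ∧ h j ≤ N - 1 := by
          simp only [hh, hx]
          constructor <;> omega
        constructor <;> omega
      rw [heq, hc]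
      exact ⟨by exact_mod_cast hωj.1, by exact_mod_cast hωj.2⟩
  refine ⟨(x, h), mem_gowersCubeParams.mpr fun ω => Finset.mem_Icc.mpr (hvert ω), hred⟩

/-- The Gowers cube product of `f 1_{[N]}` at the reduction of a cube in `[N]` is the cube
product of `f`. [folklore] -/
theorem gowersProd_extendByZero_reduce {k N : ℕ} (hNN' : N < N') (f : ℤ → ℝ)
    {p : ℤ × (Fin k → ℤ)} (hp : p ∈ gowersCubeParams k N) :
    gowersProd k (extendByZero N' N f) (reduceParams N' p).1 (reduceParams N' p).2 =
      ∏ ω : Finset (Fin k), f (cubeVertex p.1 p.2 ω) := by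
  unfold gowersProd
  refine Fintype.prod_congr _ _ fun ω => ?_
  rw [reduceParams_vertex]
  have hv := Finset.mem_Icc.mp (mem_gowersCubeParams.mp hp ω)
  exact extendByZero_intCast hNN' f hv.1 hv.2

/-- The Gowers average of a real function as a real number inside `ℂ`. [folklore] -/
theorem uniformityAvg_ofReal (k N : ℕ) (f : ℤ → ℝ) :
    uniformityAvg k N (fun n => ((f n : ℝ) : ℂ)) =
      (((∑ p ∈ gowersCubeParams k N, ∏ ω : Finset (Fin k), f (cubeVertex p.1 p.2 ω)) /
        (gowersCubeParams k N).card : ℝ) : ℂ) := by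
  unfold uniformityAvg gowersCubeTerm
  push_cast
  simp

/-- `‖f‖_{U^k[N]}^{2^k} = |∑_{cubes ⊆ [N]} ∏_ω f| / #{cubes ⊆ [N]}` for real `f`. [folklore] -/
theorem uniformityNorm_pow_ofReal (k N : ℕ) (f : ℤ → ℝ) :
    uniformityNorm k N (fun n => ((f n : ℝ) : ℂ)) ^ (2 ^ k) =
      |∑ p ∈ gowersCubeParams k N, ∏ ω : Finset (Fin k), f (cubeVertex p.1 p.2 ω)| /
        (gowersCubeParams k N).card := by
  unfold uniformityNorm
  rw [uniformityAvg_ofReal, Complex.norm_real, Real.norm_eq_abs, abs_div, Nat.abs_cast,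
    show ((2 : ℝ) ^ k)⁻¹ = ((2 ^ k : ℕ) : ℝ)⁻¹ by push_cast; ring]
  exact Real.rpow_inv_natCast_pow (by positivity) (by positivity)

/-- **Comparability of `U^k(ℤ_{N'})` and `U^k[N]`** (the upper half of Green–Tao 2010,
Lemma B.5, for `I = [N]`, `2N ≤ N'`): `‖f 1_{[N]}‖_{U^k(ℤ_{N'})}^{2^k} =
(#{cubes ⊆ [N]} / N'^{k+1}) ‖f‖_{U^k[N]}^{2^k} ≤ ‖f‖_{U^k[N]}^{2^k}` (the cubes of `ℤ_{N'}` with all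
vertices in `[N]` are exactly the reductions of the cubes of `ℤ` in `[N]`).
[cite: GreenTao2010, App. B, Lemma B.5 and (the identity before it)] -/
theorem gowersPower_extendByZero_le {k N : ℕ} (hN1 : 1 ≤ N) (hN : 2 * N ≤ N') (f : ℤ → ℝ) :
    gowersPower k (extendByZero N' N f) ≤ uniformityNorm k N (fun n => ((f n : ℝ) : ℂ)) ^ (2 ^ k) := by
  have hNN' : N < N' := by omega
  set P := gowersCubeParams k N with hP
  set T : ℤ × (Fin k → ℤ) → ℝ := fun p => ∏ ω : Finset (Fin k), f (cubeVertex p.1 p.2 ω) with hT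
  set G : ZMod N' × (Fin k → ZMod N') → ℝ :=
    fun q => gowersProd k (extendByZero N' N f) q.1 q.2 with hG
  -- the sum over all cubes of `ℤ_{N'}` is the sum over the reductions of the cubes in `[N]`
  have hinj := reduceParams_injOn (k := k) (N' := N') hNN'
  have hsum : ∑ q, G q = ∑ p ∈ P, T p := by
    classical
    rw [← Finset.sum_subset (Finset.subset_univ (P.image (reduceParams N')))]
    · rw [Finset.sum_image hinj]
      exact Finset.sum_congr rfl fun p hp => gowersProd_extendByZero_reduce hNN' f hp
    · -- cubes not coming from `[N]` contribute `0`
      intro q _ hq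
      by_contra hne
      apply hq
      have hall : ∀ ω : Finset (Fin k), extendByZero N' N f (q.1 + ∑ j ∈ ω, q.2 j) ≠ 0 := by
        intro ω h0
        exact hne (Finset.prod_eq_zero (Finset.mem_univ ω) h0)
      obtain ⟨p, hp, hpq⟩ := exists_lift_of_vertices hN q fun ω => extendByZero_ne_zero (hall ω)
      exact Finset.mem_image.mpr ⟨p, hp, hpq⟩
  -- cardinalities
  have hcardle : (P.card : ℝ) ≤ Fintype.card (ZMod N' × (Fin k → ZMod N')) := by
    classical
    have := Finset.card_le_card_of_injOn (reduceParams N') (fun p _ => Finset.mem_univ _) hinj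
    exact_mod_cast this
  have hcardpos : (0 : ℝ) < P.card := by exact_mod_cast (gowersCubeParams_nonempty k hN1).card_pos
  -- assemble
  have hgp : gowersPower k (extendByZero N' N f) =
      (∑ p ∈ P, T p) / Fintype.card (ZMod N' × (Fin k → ZMod N')) := by
    unfold gowersPower
    rw [Fintype.expect_eq_sum_div_card, hsum]
  rw [hgp, uniformityNorm_pow_ofReal]
  calc (∑ p ∈ P, T p) / Fintype.card (ZMod N' × (Fin k → ZMod N'))
      ≤ |∑ p ∈ P, T p| / Fintype.card (ZMod N' × (Fin k → ZMod N')) :=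
        div_le_div_of_nonneg_right (le_abs_self _) (Nat.cast_nonneg _)
    _ ≤ |∑ p ∈ P, T p| / P.card :=
        div_le_div_of_nonneg_left (abs_nonneg _) hcardpos hcardle

end compare


end Literature.NumberTheory.Sieve
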